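import Summits.Schanuel.Schanuel.Theses.DiophantineDichotomy
import Literature.NumberTheory.Transcendental.PhilipponCriterionProofs

/-!
# `EPiSimultaneousType`: the exponent race — `a ≥ 1/2` is necessary modulo the level-2
approximation property at `(π, e)` (negative lemmas for crux `stmt-Schanuel-6118`, route DiophantineDichotomy)

The route DiophantineDichotomy races a simultaneous approximation MEASURE at a point against an
approximation PROPERTY (existence of good algebraic approximations). This file kernel-checks the
race in general form and draws the two consequences relevant to the crux
`Summit.Schanuel.Schanuel.Theses.DiophantineDichotomy.EPiSimultaneousType`:

* `epiSimultaneousType_race` — pure real analysis: an approximation property of level `t ≥ 1` at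
  `ϑ ∈ ℂ²` (for all `Y ≥ Δ ≥ c` an admissible `γ` with `d ≤ (cΔ)^t` and
  `‖γ − ϑ‖ ≤ exp(−(log H·Δ + d·Y)/c)`; no height upper bound is needed) is incompatible with ANY
  measure `‖γ − ϑ‖ ≥ exp(−C(dᵃ log H + dᵇ))` with `a < 1/t` (any `b`, any real `C`).
* `epiSimultaneousType_half_false_of_levelTwoAP` — hence NO witness `(a, b, C)` of the crux has
  `a < 1/2`, modulo the level-2 property at `(π, e)`, which is the affine shadow of a printed
  THEOREM (Philippon 2000 = Nesterenko–Philippon, LNM 1752, Ch. 4 §4, PDF p. 61: "For `n = 1, 2`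
  the following assertion is also proved. APPROXIMATION PROPERTY 2 …"), not yet vendored in tree;
  and `epiSimultaneousType_half_false_of_approximationProperty` — unconditionally inside the
  route: the sibling crux `ApproximationProperty` (stmt-Schanuel-6117) refutes every witness with
  `a < 1/2` (its hypothesis `trdeg ℚ(π, e) ≤ 2` is automatic), so the two cruxes are jointly
  consistent only in the window `1/2 ≤ a < 1`.
  A second, independent printed route to `a ≥ 1/2`: `e` is an S-number (Popken 1929, Mahler 1932;
  Bugeaud 2004 p. 83), hence by Bugeaud 2003 (J. Théor. Nombres Bordeaux 15, 665–672; quoted in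
  Bugeaud 2004 §3.8 p. 94) for every `n` there are infinitely many `H` and real algebraic `α₁, α₂`
  of degree `≤ n`, height `≤ H` with `|π − α₁|, |e − α₂| ≤ H^{−c n}`; the pair lives in a field of
  degree `≤ n²`, so `C (n²)ᵃ ≥ c n` for all `n`, i.e. `a ≥ 1/2` (to be kernel-checked separately).
* `epiSimultaneousType_false_of_levelOneAP` — the level-1 property at `(π, e)` refutes the crux
  outright (the kernel of the support item `EPiRace`; its hypothesis is expected to be FALSE — it
  is the `trdeg ℚ(π, e) = 1` scenario — so this settles nothing about the crux).

Everything is proved; no named facts; cdisprove seat, Disproof.lean §3.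
-/

set_option linter.dupNamespace false

noncomputable section

namespace Summit.Schanuel.Schanuel.Theorems

open Polynomial
open Summit.Schanuel.Schanuel.Theses.DiophantineDichotomy

namespace EPiSimultaneousType

/-- The admissibility clause forces `d ≥ 1` (a non-zero integer polynomial with a root is
non-constant). [folklore] -/
theorem one_le_of_clause {d H : ℕ} {z : ℂ}
    (h : ∃ P : Polynomial ℤ, P ≠ 0 ∧ P.natDegree ≤ d ∧ (∀ k, |P.coeff k| ≤ (H : ℤ)) ∧
      Polynomial.aeval z P = 0) : 1 ≤ d := by
  obtain ⟨P, hP0, hdeg, -, hroot⟩ := h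
  by_contra hd
  have hd0 : P.natDegree = 0 := by omega
  rw [Polynomial.eq_C_of_natDegree_eq_zero hd0] at hroot
  simp at hroot
  apply hP0
  rw [Polynomial.eq_C_of_natDegree_eq_zero hd0, hroot, map_zero]

/-- `trdeg_ℚ ℚ(π, e) ≤ 2` (two generators). [folklore] -/
theorem trdeg_pi_e_le_two :
    Algebra.trdeg ℚ ↥(IntermediateField.adjoin ℚ (Set.range ![(Real.pi : ℂ), (Real.exp 1 : ℂ)]))
      ≤ ((2 : ℕ) : Cardinal) :=
  Literature.NumberTheory.Transcendental.Philippon1986_criterion.trdeg_adjoin_range_le (F := ℚ) _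

end EPiSimultaneousType

open EPiSimultaneousType

/-- **THE RACE** behind route DiophantineDichotomy (pure real analysis): an approximation property
of level `t ≥ 1` at `ϑ ∈ ℂ²` contradicts every simultaneous approximation measure at `ϑ` with
degree exponent `a < 1/t` — for any `b` and any real `C`. Proof: `a⁺ = max(a,0)`, `e = a⁺t < 1`;
choose `Δ ≥ max(c,1)` with `Δ^{1−e} ≥ |C|c^{1+e}` and `Y = max(Δ, c|C|·max(1, ((cΔ)^t)^{b−1}) + 1)`;
the approximant at `(Δ, Y)` has `|C|dᵃ log H ≤ (log H)Δ/c` and `|C|dᵇ < dY/c`. [folklore] -/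
theorem epiSimultaneousType_race {ϑ : Fin 2 → ℂ} {t : ℕ} (ht : 1 ≤ t) {c : ℝ} (hc1 : 1 ≤ c)
    (hAP : ∀ Δ Y : ℝ, c ≤ Δ → Δ ≤ Y → ∃ (γ : Fin 2 → ℂ) (d H : ℕ),
      (Module.finrank ℚ ↥(IntermediateField.adjoin ℚ (Set.range γ)) ≤ d ∧
        ∀ i, ∃ P : Polynomial ℤ, P ≠ 0 ∧ P.natDegree ≤ d ∧ (∀ k, |P.coeff k| ≤ (H : ℤ)) ∧
          Polynomial.aeval (γ i) P = 0) ∧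
      (d : ℝ) ≤ (c * Δ) ^ t ∧ ‖γ - ϑ‖ ≤ Real.exp (-((Real.log H * Δ + d * Y) / c)))
    {a b C : ℝ} (ha : a < 1 / t)
    (hM : ∀ (d H : ℕ) (γ : Fin 2 → ℂ),
      Module.finrank ℚ ↥(IntermediateField.adjoin ℚ (Set.range γ)) ≤ d →
      (∀ i, ∃ P : Polynomial ℤ, P ≠ 0 ∧ P.natDegree ≤ d ∧ (∀ k, |P.coeff k| ≤ (H : ℤ)) ∧
        Polynomial.aeval (γ i) P = 0) →
      Real.exp (-(C * ((d : ℝ) ^ a * Real.log H + (d : ℝ) ^ b))) ≤ ‖γ - ϑ‖) : False := by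
  have hc0 : 0 < c := by linarith
  have ht0 : (0 : ℝ) < t := by exact_mod_cast ht
  set a' : ℝ := max a 0 with ha'def
  have ha'0 : 0 ≤ a' := le_max_right _ _
  have haa' : a ≤ a' := le_max_left _ _
  set e : ℝ := a' * t with hedef
  have he0 : 0 ≤ e := by positivity
  have he1 : e < 1 := by
    rcases le_or_gt a 0 with h | h
    · have : a' = 0 := by rw [ha'def, max_eq_right h]
      rw [hedef, this, zero_mul]; exact zero_lt_one
    · have : a' = a := by rw [ha'def, max_eq_left h.le]
      rw [hedef, this]
      rwa [lt_div_iff₀ ht0] at ha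
  obtain ⟨Δ, hΔc, hΔ1, hΔbig⟩ :
      ∃ Δ : ℝ, c ≤ Δ ∧ 1 ≤ Δ ∧ |C| * c ^ (1 + e) ≤ Δ ^ (1 - e) := by
    have hten : Filter.Tendsto (fun x : ℝ => x ^ (1 - e)) Filter.atTop Filter.atTop :=
      tendsto_rpow_atTop (by linarith)
    have hev := hten.eventually_ge_atTop (|C| * c ^ (1 + e))
    obtain ⟨Δ, hΔ⟩ := ((Filter.eventually_ge_atTop (max c 1)).and hev).exists
    exact ⟨Δ, (le_max_left _ _).trans hΔ.1, (le_max_right _ _).trans hΔ.1, hΔ.2⟩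
  have hΔ0 : 0 < Δ := by linarith
  set D : ℝ := (c * Δ) ^ t with hDdef
  have hD1 : 1 ≤ D := one_le_pow₀ (by nlinarith)
  set M : ℝ := max 1 (D ^ (b - 1)) with hMdef
  have hM0 : 0 ≤ M := le_trans zero_le_one (le_max_left _ _)
  set Y : ℝ := max Δ (c * |C| * M + 1) with hYdef
  have hΔY : Δ ≤ Y := le_max_left _ _
  obtain ⟨γ, d, H, ⟨hfin, hcl⟩, hdD, hdist⟩ := hAP Δ Y hΔc hΔY
  have hd1 : 1 ≤ d := one_le_of_clause (hcl 0)
  have hd1' : (1 : ℝ) ≤ d := by exact_mod_cast hd1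
  have hd0 : (0 : ℝ) < d := by linarith
  have hlog : 0 ≤ Real.log H := Real.log_natCast_nonneg H
  have hcmp := (hM d H γ hfin hcl).trans hdist
  rw [Real.exp_le_exp, neg_le_neg_iff] at hcmp
  have habs : C * ((d : ℝ) ^ a * Real.log H + (d : ℝ) ^ b) ≤
      |C| * (d : ℝ) ^ a * Real.log H + |C| * (d : ℝ) ^ b := by
    have h0 : 0 ≤ (d : ℝ) ^ a * Real.log H + (d : ℝ) ^ b := by positivity
    calc C * ((d : ℝ) ^ a * Real.log H + (d : ℝ) ^ b)
        ≤ |C| * ((d : ℝ) ^ a * Real.log H + (d : ℝ) ^ b) := by gcongr; exact le_abs_self C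
      _ = _ := by ring
  have hda : (d : ℝ) ^ a ≤ (c * Δ) ^ e := by
    calc (d : ℝ) ^ a ≤ (d : ℝ) ^ a' := Real.rpow_le_rpow_of_exponent_le hd1' haa'
      _ ≤ D ^ a' := Real.rpow_le_rpow hd0.le hdD ha'0
      _ = (c * Δ) ^ e := by
        rw [hDdef, hedef, mul_comm a' (t : ℝ), Real.rpow_natCast_mul (by positivity)]
  have hclaim1 : |C| * (d : ℝ) ^ a * Real.log H ≤ Real.log H * Δ / c := by
    have key : c * (|C| * (d : ℝ) ^ a) ≤ Δ := by
      calc c * (|C| * (d : ℝ) ^ a) ≤ c * (|C| * (c * Δ) ^ e) := by gcongr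
        _ = |C| * c ^ (1 + e) * Δ ^ e := by
          rw [Real.mul_rpow hc0.le hΔ0.le, Real.rpow_add hc0, Real.rpow_one]; ring
        _ ≤ Δ ^ (1 - e) * Δ ^ e := by gcongr
        _ = Δ := by
          rw [← Real.rpow_add hΔ0]; simp
    rw [le_div_iff₀ hc0]
    calc |C| * (d : ℝ) ^ a * Real.log H * c = (c * (|C| * (d : ℝ) ^ a)) * Real.log H := by ring
      _ ≤ Δ * Real.log H := by gcongr
      _ = Real.log H * Δ := by ring
  have hdb : (d : ℝ) ^ (b - 1) ≤ M := by
    rcases le_or_gt 0 (b - 1) with hb | hb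
    · exact (Real.rpow_le_rpow hd0.le hdD hb).trans (le_max_right _ _)
    · exact (Real.rpow_le_one_of_one_le_of_nonpos hd1' hb.le).trans (le_max_left _ _)
  have hclaim2 : |C| * (d : ℝ) ^ b < d * Y / c := by
    have hsplit : (d : ℝ) ^ b = d * (d : ℝ) ^ (b - 1) := by
      conv_lhs => rw [show b = 1 + (b - 1) by ring, Real.rpow_add hd0, Real.rpow_one]
    rw [hsplit, lt_div_iff₀ hc0]
    have hY : c * |C| * M + 1 ≤ Y := le_max_right _ _
    calc |C| * (d * (d : ℝ) ^ (b - 1)) * c = d * (c * |C| * (d : ℝ) ^ (b - 1)) := by ring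
      _ ≤ d * (c * |C| * M) := by gcongr
      _ < d * (c * |C| * M + 1) := by nlinarith
      _ ≤ d * Y := by gcongr
  have : (Real.log H * Δ + d * Y) / c ≤ |C| * (d : ℝ) ^ a * Real.log H + |C| * (d : ℝ) ^ b :=
    hcmp.trans habs
  rw [add_div] at this
  linarith

/-- **`a ≥ 1/2` is necessary in `EPiSimultaneousType`, modulo the level-2 approximation property
at `(π, e)`** (hypothesis `hAP2`: for all `Y ≥ Δ ≥ c` an admissible `γ` with `[ℚ(γ):ℚ] ≤ d ≤ (cΔ)²`
and `max(|γ₁ − π|, |γ₂ − e|) ≤ exp(−(log H·Δ + dY)/c)` — the affine shadow at `x = (1 : π : e)`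
of Philippon's Approximation Property 2 in `P²`, a printed theorem, LNM 1752 Ch. 4 §4 PDF p. 61):
the crux with `a < 1` strengthened to `a < 1/2` is then false. [folklore] -/
theorem epiSimultaneousType_half_false_of_levelTwoAP
    (hAP2 : ∃ c : ℝ, 1 ≤ c ∧ ∀ Δ Y : ℝ, c ≤ Δ → Δ ≤ Y → ∃ (γ : Fin 2 → ℂ) (d H : ℕ),
      (Module.finrank ℚ ↥(IntermediateField.adjoin ℚ (Set.range γ)) ≤ d ∧
        ∀ i, ∃ P : Polynomial ℤ, P ≠ 0 ∧ P.natDegree ≤ d ∧ (∀ k, |P.coeff k| ≤ (H : ℤ)) ∧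
          Polynomial.aeval (γ i) P = 0) ∧
      (d : ℝ) ≤ (c * Δ) ^ 2 ∧
      ‖γ - ![(Real.pi : ℂ), (Real.exp 1 : ℂ)]‖ ≤ Real.exp (-((Real.log H * Δ + d * Y) / c))) :
    ¬ ∃ a b C : ℝ, a < 1 / 2 ∧ 0 < C ∧ ∀ (d H : ℕ) (γ : Fin 2 → ℂ),
      Module.finrank ℚ ↥(IntermediateField.adjoin ℚ (Set.range γ)) ≤ d →
      (∀ i, ∃ P : Polynomial ℤ, P ≠ 0 ∧ P.natDegree ≤ d ∧ (∀ k, |P.coeff k| ≤ (H : ℤ)) ∧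
        Polynomial.aeval (γ i) P = 0) →
      Real.exp (-(C * ((d : ℝ) ^ a * Real.log H + (d : ℝ) ^ b))) ≤
        ‖γ - ![(Real.pi : ℂ), (Real.exp 1 : ℂ)]‖ := by
  rintro ⟨a, b, C, ha, -, hM⟩
  obtain ⟨c, hc1, hAP⟩ := hAP2
  exact epiSimultaneousType_race (t := 2) (by norm_num) hc1 hAP (by simpa using ha) hM

/-- **Inside route DiophantineDichotomy the two cruxes are jointly consistent only for
`1/2 ≤ a < 1`**: the sibling crux `ApproximationProperty` (stmt-Schanuel-6117, all `t`) contains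
the level-2 property at `(π, e)` (hypothesis `trdeg ℚ(π, e) ≤ 2` automatic), hence refutes every
witness of `EPiSimultaneousType` with `a < 1/2`. [folklore] -/
theorem epiSimultaneousType_half_false_of_approximationProperty (h : ApproximationProperty) :
    ¬ ∃ a b C : ℝ, a < 1 / 2 ∧ 0 < C ∧ ∀ (d H : ℕ) (γ : Fin 2 → ℂ),
      Module.finrank ℚ ↥(IntermediateField.adjoin ℚ (Set.range γ)) ≤ d →
      (∀ i, ∃ P : Polynomial ℤ, P ≠ 0 ∧ P.natDegree ≤ d ∧ (∀ k, |P.coeff k| ≤ (H : ℤ)) ∧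
        Polynomial.aeval (γ i) P = 0) →
      Real.exp (-(C * ((d : ℝ) ^ a * Real.log H + (d : ℝ) ^ b))) ≤
        ‖γ - ![(Real.pi : ℂ), (Real.exp 1 : ℂ)]‖ := by
  apply epiSimultaneousType_half_false_of_levelTwoAP
  obtain ⟨c, hc1, hc⟩ := h (Fin 2) ![(Real.pi : ℂ), (Real.exp 1 : ℂ)] 2 (by norm_num)
    trdeg_pi_e_le_two
  refine ⟨c, hc1, fun Δ Y hΔ hY => ?_⟩
  obtain ⟨γ, d, H, hfin, hcl, hd, -, hdist⟩ := hc Δ Y hΔ hY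
  exact ⟨γ, d, H, ⟨hfin, hcl⟩, hd, hdist⟩

/-- **The level-1 approximation property at `(π, e)` refutes `EPiSimultaneousType`** (the `t = 1`
race; kernel of the support item `EPiRace`, stmt-Schanuel-11044). This settles NOTHING about the
crux: the hypothesis is expected to be false (by Laurent–Roy 1999 it holds if `trdeg ℚ(π, e) = 1`,
i.e. if `e` and `π` were algebraically dependent). [folklore] -/
theorem epiSimultaneousType_false_of_levelOneAP
    (hAP1 : ∃ c : ℝ, 1 ≤ c ∧ ∀ Δ Y : ℝ, c ≤ Δ → Δ ≤ Y → ∃ (γ : Fin 2 → ℂ) (d H : ℕ),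
      (Module.finrank ℚ ↥(IntermediateField.adjoin ℚ (Set.range γ)) ≤ d ∧
        ∀ i, ∃ P : Polynomial ℤ, P ≠ 0 ∧ P.natDegree ≤ d ∧ (∀ k, |P.coeff k| ≤ (H : ℤ)) ∧
          Polynomial.aeval (γ i) P = 0) ∧
      (d : ℝ) ≤ (c * Δ) ^ 1 ∧
      ‖γ - ![(Real.pi : ℂ), (Real.exp 1 : ℂ)]‖ ≤ Real.exp (-((Real.log H * Δ + d * Y) / c))) :
    ¬ EPiSimultaneousType := by
  rintro ⟨a, b, C, ha, -, hM⟩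
  obtain ⟨c, hc1, hAP⟩ := hAP1
  exact epiSimultaneousType_race (t := 1) le_rfl hc1 hAP (by simpa using ha) hM

end Summit.Schanuel.Schanuel.Theorems

end
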